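import Literature.AlgebraicGeometry.Resolution.BlowupChartRsop
import HarnessLib

/-!
# [OURS · L1 W4.6, rungs (i)/(ii) — the dictionary, SCHEME HALF, brick 4] A RATIONAL point of the exceptional
# divisor of a point blow-up: its prime in the chart ring, and the maximal ideal of its local ring, are
# generated by the exceptional parameter and the recentred quotients

Cell res-hironaka (LADDER-RESOLUTION rung L, D-0089), slot W4.6, seat res-L1-s46-pv-2 (gen 2). Host: route
`WildCones`, crux `ClassicalRegimes` (stmt-ResolutionOfSingularities-16884), `--supports … --as helper`.

HONEST FRAMING. Everything here is OURS and is ordinary commutative algebra about the tree's chart rings of a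
blowing up (`Literature/AlgebraicGeometry/Resolution/BlowupChartRsop.lean`, `BlowupChartQuasiRegular.lean`);
NOTHING here is a statement of H. Hironaka's manuscript [Hironaka2017] and nothing of it is used; no FACT-LIST
premise. AI review is weaker than expert review.

## What this brick supplies

Brick 1 (`Theorems/WildConesCampaignW46FormalChart.lean`, `FormalChart.exists_ringEquiv_chart`) recognises the
completed local ring `C` of the blow-up at a point `ξ′` over `ξ` as `κ⟦X⟧` with `π̂^♯` = chart substitution,
GIVEN that `𝔪_C` is generated by the exceptional parameter and the recentred quotients `e_j − τ_j`. This file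
proves that hypothesis at the level where the tree presents the local rings of a blowing up
(`IsBlowup.exists_reesChart_stalk`, `BlowupStalkCharts.lean`: `𝒪_{X′,x′}` is a localisation of the chart ring
`B = (R[𝔪t])_{(cᵢt)}`, `R = 𝒪_{X,ξ}`, at a prime `𝔓` over `𝔪_R`). Let `R` be a regular local ring with residue
field `κ`, `c = (c₁, …, c_n)` a regular system of parameters (so `I = (c) = 𝔪_R` and the blow-up is the blow-up
of the CLOSED POINT), `B = chartRing c i`, `φ = chartBase c i : R → B`, `e_j = chartGen c i j` (`φ c_j = φ cᵢ · e_j`),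
and `𝔓` a prime of `B` over `𝔪_R` that is **`κ`-RATIONAL**: for some `τ : Fin n → R`, `e_j − φ(τ_j) ∈ 𝔓` (`j ≠ i`)
— every closed point of the exceptional divisor `B/(cᵢ) ≅ κ[T_j : j ≠ i]` (`chartQuotEquiv`) with residue
field `κ` is of this form, and over an algebraically closed `κ` every closed point is.

Following `BlowupChartRsop.lean`, the local statements are proved for ABSTRACT chart data `(A, ψ : R → A, u,
ε : (R/(c))[T] ≅ A/(ψ cᵢ))` (any ring presented like the chart; this keeps `Algebra (chartRing c i) L` out of
statements) and specialised to the Rees chart at the end: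

* `prime_eq_span_of_rational` (abstract) / `prime_eq_span_of_rational_reesChart` — **`𝔓 = (φ cᵢ) +
  (e_j − φ τ_j : j ≠ i)`**: modulo `cᵢ` the chart is the polynomial ring `κ[T]` (`chartQuotEquiv`), where a
  polynomial is its value at `τ̄` plus an element of `(T_j − τ̄_j)` (`MvPolynomial.sub_C_eval_mem_span`), and the
  value, lifted to `R`, lies in `𝔓 ∩ R = 𝔪_R = (c) ↦ (φ cᵢ)`.
* `maximalIdeal_eq_of_rational`, `span_range_eq_maximalIdeal_of_rational` — hence for any localisation `L` of the
  chart at `𝔓` (e.g. `𝒪_{Z′,ξ′}`, by `IsBlowup.exists_reesChart_stalk`): **`𝔪_L = (cᵢ) + (e_j − τ_j : j ≠ i)`**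
  — hypothesis `hgen` of brick 1 before completion.
* `exists_sub_algebraMap_mem_maximalIdeal_of_rational` — **rationality of `L`**: every element of `L` is congruent
  modulo `𝔪_L` to the image of an element of `R` — hypothesis `hres` of brick 1 before completion.

Not here: the dimension of `L` and the completion step (next bricks).

References: The Stacks Project, Tags 0804, 0BIQ (charts of a blowing up; the exceptional divisor of the blow-up of
a regular sequence is a projective space); `BlowupChartRsop.lean` (`chartQuotEquiv`, `isQuasiRegular_centre`);
H. Hironaka, ms. 2017, Th. 16.6 p.84 — ROLE of «the blowup `π : Z′ → Z` with center `D`» only, under adjudication,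
not cited as fact. [StacksProject] [folklore]
-/

noncomputable section

-- single-problem summit: the doubled namespace component `ResolutionOfSingularities` is forced
set_option linter.dupNamespace false

open IsLocalRing

namespace Summit.ResolutionOfSingularities.ResolutionOfSingularities.Theorems

namespace CampaignW46.ChartPoint

open Literature.AlgebraicGeometry.Resolution

universe u

/-! ## Taylor's formula to first order in a polynomial ring: `P ≡ P(τ)` modulo `(T_j − τ_j)` -/

/-- **`P − P(τ) ∈ (T_j − τ_j : j)`** for a polynomial `P` over any commutative ring and any point `τ`: modulo
`(T_j − τ_j)` every polynomial is the constant `P(τ)` (induction on `P`). [folklore] -/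
theorem _root_.MvPolynomial.sub_C_eval_mem_span {σ : Type*} {k : Type*} [CommRing k] (τ : σ → k)
    (P : MvPolynomial σ k) :
    P - MvPolynomial.C (MvPolynomial.eval τ P) ∈
      Ideal.span (Set.range fun j : σ => (MvPolynomial.X j - MvPolynomial.C (τ j) : MvPolynomial σ k)) := by
  rw [← Ideal.Quotient.eq]
  induction P using MvPolynomial.induction_on with
  | C a => rw [MvPolynomial.eval_C]
  | add p q hp hq => rw [map_add, map_add, MvPolynomial.C_add, map_add, hp, hq]
  | mul_X p j hp =>
    rw [map_mul, hp, map_mul, MvPolynomial.eval_X, MvPolynomial.C_mul, map_mul]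
    congr 1
    rw [Ideal.Quotient.eq]
    exact Ideal.subset_span ⟨j, rfl⟩

/-! ## Abstract chart data (as in `BlowupChartRsop.lean`): the prime of a rational point

To keep instance search light (cf. `BlowupChartRsop.lean`), the local statements are proved for ABSTRACT chart
data: a ring `A` with `ψ : R → A`, elements `u_j` (`ψ c_j = ψ cᵢ · u_j` in the application), and a ring
isomorphism `ε : (R/(c))[T_j : j ≠ i] ≅ A/(ψ cᵢ)` with `ε(r̄) = ψ r`, `ε(T_j) = u_j`; the Rees chart
`(chartRing c i, chartBase c i, chartGen c i, chartQuotEquiv c i _)` is such a datum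
(`prime_eq_span_of_rational_reesChart`). -/

section Abstract

variable {R : Type u} [CommRing R] [IsLocalRing R] {n : ℕ} (c : Fin n → R) (i : Fin n)
  (hz : Ideal.span (Set.range c) = maximalIdeal R)
  {A : Type u} [CommRing A] (ψ : R →+* A) (u : Fin n → A)
  (ε : MvPolynomial {j : Fin n // j ≠ i} (R ⧸ Ideal.span (Set.range c)) ≃+* A ⧸ Ideal.span {ψ (c i)})
  (hεC : ∀ r : R, ε (MvPolynomial.C (Ideal.Quotient.mk (Ideal.span (Set.range c)) r)) =
    Ideal.Quotient.mk _ (ψ r))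
  (hεX : ∀ j : {j : Fin n // j ≠ i}, ε (MvPolynomial.X j) = Ideal.Quotient.mk _ (u j.1))

include hεC in
omit [IsLocalRing R] in
/-- `ψ(r) ∈ (ψ cᵢ)` for `r ∈ (c)` (`ε(r̄) = ψ r` and `r̄ = 0`). [folklore] -/
theorem map_mem_span_of_mem {r : R} (hr : r ∈ Ideal.span (Set.range c)) : ψ r ∈ Ideal.span {ψ (c i)} := by
  rw [← Ideal.Quotient.eq_zero_iff_mem, ← hεC, Ideal.Quotient.eq_zero_iff_mem.2 hr, MvPolynomial.C_0, map_zero]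

include hεC hεX in
omit [IsLocalRing R] in
/-- **Modulo `ψ cᵢ`, every element of `A` is a constant from `R` plus an element of `(u_j − ψ τ_j : j ≠ i)`**
(Taylor at the point `τ̄` of `A/(ψ cᵢ) ≅ κ[T_j : j ≠ i]`). [folklore] -/
theorem exists_sub_map_mem_map (τ : Fin n → R) (x : A) :
    ∃ r : R, Ideal.Quotient.mk (Ideal.span {ψ (c i)}) x - Ideal.Quotient.mk (Ideal.span {ψ (c i)}) (ψ r) ∈
      (Ideal.span (Set.range fun j : {j : Fin n // j ≠ i} => u j.1 - ψ (τ j.1))).map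
        (Ideal.Quotient.mk (Ideal.span {ψ (c i)})) := by
  classical
  obtain ⟨Px, hPx⟩ := ε.surjective (Ideal.Quotient.mk (Ideal.span {ψ (c i)}) x)
  obtain ⟨r, hr⟩ := Ideal.Quotient.mk_surjective
    (MvPolynomial.eval (fun j : {j : Fin n // j ≠ i} => Ideal.Quotient.mk (Ideal.span (Set.range c)) (τ j.1)) Px)
  refine ⟨r, ?_⟩
  have hT := Ideal.mem_map_of_mem
    (ε : MvPolynomial {j : Fin n // j ≠ i} (R ⧸ Ideal.span (Set.range c)) →+* A ⧸ Ideal.span {ψ (c i)})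
    (MvPolynomial.sub_C_eval_mem_span
      (fun j : {j : Fin n // j ≠ i} => Ideal.Quotient.mk (Ideal.span (Set.range c)) (τ j.1)) Px)
  rw [map_sub, ← hr, RingHom.coe_coe, hPx, hεC, Ideal.map_span, ← Set.range_comp] at hT
  have hfun : ((⇑(ε : MvPolynomial {j : Fin n // j ≠ i} (R ⧸ Ideal.span (Set.range c)) →+* A ⧸ Ideal.span {ψ (c i)})) ∘
      fun j : {j : Fin n // j ≠ i} =>
        (MvPolynomial.X j - MvPolynomial.C (Ideal.Quotient.mk (Ideal.span (Set.range c)) (τ j.1)) :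
          MvPolynomial {j : Fin n // j ≠ i} (R ⧸ Ideal.span (Set.range c)))) =
      (⇑(Ideal.Quotient.mk (Ideal.span {ψ (c i)})) ∘ fun j : {j : Fin n // j ≠ i} => u j.1 - ψ (τ j.1)) := by
    funext j
    rw [Function.comp_apply, Function.comp_apply, RingHom.coe_coe, map_sub, map_sub, hεX, hεC]
  rw [hfun] at hT
  rw [Ideal.map_span, ← Set.range_comp]
  exact hT

include hz hεC hεX in
/-- [OURS · L1 W4.6 — DICTIONARY, SCHEME HALF, brick 4 (abstract chart); replaces the role of «the closed point
`ξ′ ∈ π⁻¹(ξ)` of the blowup» (H. Hironaka, ms. 2017, Th. 16.6 p.84 l.10) AT A RATIONAL POINT; NOT a statement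
of the manuscript] **The prime of a `κ`-rational point of the exceptional divisor.** If `𝔓 ⊂ A` is a prime over
`𝔪_R = (c)` containing `u_j − ψ(τ_j)` for all `j ≠ i`, then `𝔓 = (ψ cᵢ) + (u_j − ψ τ_j : j ≠ i)`.
[cite: StacksProject, Tag 0BIQ] [folklore] -/
theorem prime_eq_span_of_rational (𝔓 : Ideal A) [𝔓.IsPrime] (h𝔓 : 𝔓.comap ψ = maximalIdeal R)
    (τ : Fin n → R) (hτ : ∀ j, j ≠ i → u j - ψ (τ j) ∈ 𝔓) :
    𝔓 = Ideal.span {ψ (c i)} ⊔ Ideal.span (Set.range fun j : {j : Fin n // j ≠ i} => u j.1 - ψ (τ j.1)) := by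
  classical
  have hKP : Ideal.span {ψ (c i)} ≤ 𝔓 := by
    rw [Ideal.span_singleton_le_iff_mem, ← Ideal.mem_comap, h𝔓, ← hz]
    exact Ideal.subset_span ⟨i, rfl⟩
  have hSP : Ideal.span (Set.range fun j : {j : Fin n // j ≠ i} => u j.1 - ψ (τ j.1)) ≤ 𝔓 := by
    rw [Ideal.span_le]
    rintro _ ⟨j, rfl⟩
    exact hτ j.1 j.2
  refine le_antisymm ?_ (sup_le hKP hSP)
  intro x hx
  obtain ⟨r, hr⟩ := exists_sub_map_mem_map c i ψ u ε hεC hεX τ x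
  -- pull back to `A`: `x − ψ r ∈ S ⊔ K`
  have h5 : x - ψ r ∈ Ideal.span (Set.range fun j : {j : Fin n // j ≠ i} => u j.1 - ψ (τ j.1)) ⊔
      Ideal.span {ψ (c i)} := by
    rw [← map_sub, ← Ideal.mem_comap, Ideal.comap_map_of_surjective _ Ideal.Quotient.mk_surjective,
      ← RingHom.ker_eq_comap_bot, Ideal.mk_ker] at hr
    exact hr
  -- `ψ r ∈ 𝔓`, hence `r ∈ 𝔪_R = (c)`, hence `ψ r ∈ (ψ cᵢ)`
  have h7 : ψ r ∈ 𝔓 := (Submodule.sub_mem_iff_right 𝔓 hx).1 ((sup_le hSP hKP) h5)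
  have h8 : ψ r ∈ Ideal.span {ψ (c i)} := by
    rw [← Ideal.mem_comap, h𝔓, ← hz] at h7
    exact map_mem_span_of_mem c i ψ ε hεC h7
  have h9 : x = (x - ψ r) + ψ r := by ring
  rw [h9, sup_comm]
  exact Ideal.add_mem _ h5 (Ideal.mem_sup_right h8)

include hz hεC hεX in
/-- [OURS · L1 W4.6 — DICTIONARY, SCHEME HALF, brick 4 (abstract chart); replaces the role of «the local ring of
the blowup `Z′` at a closed point `ξ′` over the centre» (H. Hironaka, ms. 2017, Th. 16.6 p.84) AT A RATIONAL POINT;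
NOT a statement of the manuscript] **The maximal ideal of the local ring at a `κ`-rational point of the
exceptional divisor**: for a localisation `L` of `A` at such a prime `𝔓` — by `IsBlowup.exists_reesChart_stalk`
the stalk `𝒪_{Z′,ξ′}` is one, for the Rees chart — `𝔪_L` is generated by the exceptional parameter `ψ cᵢ` and the
recentred quotients `u_j − ψ τ_j`, `j ≠ i`. This is hypothesis `hgen` of `FormalChart.exists_ringEquiv_chart`
before completion. [cite: StacksProject, Tag 0BIQ] [folklore] -/
theorem maximalIdeal_eq_of_rational (𝔓 : Ideal A) [𝔓.IsPrime] (h𝔓 : 𝔓.comap ψ = maximalIdeal R)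
    (τ : Fin n → R) (hτ : ∀ j, j ≠ i → u j - ψ (τ j) ∈ 𝔓)
    (L : Type u) [CommRing L] [IsLocalRing L] [Algebra A L] [IsLocalization.AtPrime L 𝔓] :
    maximalIdeal L = Ideal.span {algebraMap A L (ψ (c i))} ⊔
      Ideal.span (Set.range fun j : {j : Fin n // j ≠ i} => algebraMap A L (u j.1) - algebraMap A L (ψ (τ j.1))) := by
  have hfun : ((⇑(algebraMap A L)) ∘ fun j : {j : Fin n // j ≠ i} => u j.1 - ψ (τ j.1)) =
      fun j : {j : Fin n // j ≠ i} => algebraMap A L (u j.1) - algebraMap A L (ψ (τ j.1)) := by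
    funext j
    rw [Function.comp_apply, map_sub]
  rw [← IsLocalization.AtPrime.map_eq_maximalIdeal 𝔓 L, prime_eq_span_of_rational c i hz ψ u ε hεC hεX 𝔓 h𝔓 τ hτ,
    Ideal.map_sup, Ideal.map_span, Set.image_singleton, Ideal.map_span, ← Set.range_comp, hfun]

include hz hεC hεX in
/-- The same generating set indexed by `Fin n`, in the shape of brick 1's hypothesis `hgen` (generator at `i`: the
exceptional parameter; at `j ≠ i`: the recentred quotient). [folklore] -/
theorem span_range_eq_maximalIdeal_of_rational (𝔓 : Ideal A) [𝔓.IsPrime] (h𝔓 : 𝔓.comap ψ = maximalIdeal R)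
    (τ : Fin n → R) (hτ : ∀ j, j ≠ i → u j - ψ (τ j) ∈ 𝔓)
    (L : Type u) [CommRing L] [IsLocalRing L] [Algebra A L] [IsLocalization.AtPrime L 𝔓] :
    Ideal.span (Set.range fun j : Fin n =>
      if j = i then algebraMap A L (ψ (c i)) else algebraMap A L (u j) - algebraMap A L (ψ (τ j))) =
    maximalIdeal L := by
  classical
  rw [maximalIdeal_eq_of_rational c i hz ψ u ε hεC hεX 𝔓 h𝔓 τ hτ L]
  apply le_antisymm
  · rw [Ideal.span_le]
    rintro _ ⟨j, rfl⟩
    by_cases hj : j = i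
    · simp only [hj, if_true]
      exact Ideal.mem_sup_left (Ideal.subset_span rfl)
    · simp only [if_neg hj]
      exact Ideal.mem_sup_right (Ideal.subset_span ⟨⟨j, hj⟩, rfl⟩)
  · refine sup_le ?_ ?_
    · rw [Ideal.span_singleton_le_iff_mem]
      refine Ideal.subset_span ⟨i, ?_⟩
      simp
    · rw [Ideal.span_le]
      rintro _ ⟨j, rfl⟩
      refine Ideal.subset_span ⟨j.1, ?_⟩
      simp [j.2]

include hεC hεX in
omit [IsLocalRing R] in
/-- **Rationality**: at such a prime every element of `A` is congruent to some `ψ(r)` modulo `𝔓`. [folklore] -/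
theorem exists_sub_map_mem_of_rational (𝔓 : Ideal A) (hK : Ideal.span {ψ (c i)} ≤ 𝔓)
    (τ : Fin n → R) (hτ : ∀ j, j ≠ i → u j - ψ (τ j) ∈ 𝔓) (x : A) : ∃ r : R, x - ψ r ∈ 𝔓 := by
  obtain ⟨r, hr⟩ := exists_sub_map_mem_map c i ψ u ε hεC hεX τ x
  refine ⟨r, ?_⟩
  rw [← map_sub, ← Ideal.mem_comap, Ideal.comap_map_of_surjective _ Ideal.Quotient.mk_surjective,
    ← RingHom.ker_eq_comap_bot, Ideal.mk_ker] at hr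
  refine (sup_le ?_ hK) hr
  rw [Ideal.span_le]
  rintro _ ⟨j, rfl⟩
  exact hτ j.1 j.2

include hεC hεX in
omit [IsLocalRing R] in
/-- **Rationality of the local ring**: every element of a localisation `L` of `A` at such a prime `𝔓` over `𝔪_R`
is congruent modulo `𝔪_L` to the image of an element of `R` (the residue field of `L` is that of `R`). This is
hypothesis `hres` of `FormalChart.exists_ringEquiv_chart` before completion. [folklore] -/
theorem exists_sub_algebraMap_mem_maximalIdeal_of_rational [IsLocalRing R] (𝔓 : Ideal A) [𝔓.IsPrime]
    (h𝔓 : 𝔓.comap ψ = maximalIdeal R) (hK : Ideal.span {ψ (c i)} ≤ 𝔓)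
    (τ : Fin n → R) (hτ : ∀ j, j ≠ i → u j - ψ (τ j) ∈ 𝔓)
    (L : Type u) [CommRing L] [IsLocalRing L] [Algebra A L] [IsLocalization.AtPrime L 𝔓] (y : L) :
    ∃ r : R, y - algebraMap A L (ψ r) ∈ maximalIdeal L := by
  obtain ⟨⟨a, s⟩, hy⟩ := IsLocalization.surj 𝔓.primeCompl y
  -- `y · s = a` with `s ∉ 𝔓`
  obtain ⟨ra, hra⟩ := exists_sub_map_mem_of_rational c i ψ u ε hεC hεX 𝔓 hK τ hτ a
  obtain ⟨rs, hrs⟩ := exists_sub_map_mem_of_rational c i ψ u ε hεC hεX 𝔓 hK τ hτ s.1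
  have hs : (s.1 : A) ∉ 𝔓 := s.2
  have hrs' : rs ∉ maximalIdeal R := by
    intro h
    rw [← h𝔓, Ideal.mem_comap] at h
    exact hs (by simpa using 𝔓.add_mem hrs h)
  have hu : IsUnit rs := (IsLocalRing.notMem_maximalIdeal.1 hrs')
  obtain ⟨w, hw⟩ := hu.exists_right_inv
  refine ⟨ra * w, ?_⟩
  have hmax : 𝔓.map (algebraMap A L) = maximalIdeal L := IsLocalization.AtPrime.map_eq_maximalIdeal 𝔓 L
  -- in `L`: `y · s = a`, `a ≡ ψ ra`, `s ≡ ψ rs` modulo `𝔪_L`, and `ψ rs · ψ w = 1`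
  have h1 : algebraMap A L a - algebraMap A L (ψ ra) ∈ maximalIdeal L := by
    rw [← map_sub, ← hmax]; exact Ideal.mem_map_of_mem _ hra
  have h2 : algebraMap A L s.1 - algebraMap A L (ψ rs) ∈ maximalIdeal L := by
    rw [← map_sub, ← hmax]; exact Ideal.mem_map_of_mem _ hrs
  have h3 : y * algebraMap A L (ψ rs) - algebraMap A L (ψ ra) ∈ maximalIdeal L := by
    have e : y * algebraMap A L (ψ rs) - algebraMap A L (ψ ra) =
        (algebraMap A L a - algebraMap A L (ψ ra)) - y * (algebraMap A L s.1 - algebraMap A L (ψ rs)) := by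
      rw [← hy]; ring
    rw [e]
    exact Ideal.sub_mem _ h1 (Ideal.mul_mem_left _ _ h2)
  have hone : algebraMap A L (ψ rs) * algebraMap A L (ψ w) = 1 := by
    rw [← map_mul, ← map_mul, hw, map_one, map_one]
  have e : y - algebraMap A L (ψ (ra * w)) =
      (y * algebraMap A L (ψ rs) - algebraMap A L (ψ ra)) * algebraMap A L (ψ w) := by
    rw [map_mul, map_mul, sub_mul, mul_assoc, hone, mul_one]
  rw [e]
  exact Ideal.mul_mem_right _ _ h3

end Abstract

/-! ## The Rees chart is such a datum -/

section ReesChart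

variable {R : Type u} [CommRing R] [IsRegularLocalRing R] {n : ℕ} (c : Fin n → R) (i : Fin n)
  (hz : Ideal.span (Set.range c) = maximalIdeal R) (hd : (maximalIdeal R).spanFinrank = n)

include hz hd in
/-- [OURS · L1 W4.6 — DICTIONARY, SCHEME HALF, brick 4 for the Rees chart `B = (R[𝔪t])_{(cᵢt)}` of the blow-up
of the closed point of a regular local ring; NOT a statement of the manuscript] A prime `𝔓` of `chartRing c i`
over `𝔪_R` containing `e_j − φ(τ_j)` (`j ≠ i`) is `(φ cᵢ) + (e_j − φ τ_j : j ≠ i)`.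
[cite: StacksProject, Tag 0BIQ] [folklore] -/
theorem prime_eq_span_of_rational_reesChart (𝔓 : Ideal (chartRing c i)) [𝔓.IsPrime]
    (h𝔓 : 𝔓.comap (chartBase c i) = maximalIdeal R) (τ : Fin n → R)
    (hτ : ∀ j, j ≠ i → chartGen c i j - chartBase c i (τ j) ∈ 𝔓) :
    𝔓 = Ideal.span {chartBase c i (c i)} ⊔
      Ideal.span (Set.range fun j : {j : Fin n // j ≠ i} => chartGen c i j.1 - chartBase c i (τ j.1)) :=
  prime_eq_span_of_rational c i hz (chartBase c i) (chartGen c i)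
    (chartQuotEquiv c i (isQuasiRegular_rsop_comp hd c hz id Function.injective_id))
    (chartQuotMap_C c i) (chartQuotMap_X c i) 𝔓 h𝔓 τ hτ

end ReesChart

end CampaignW46.ChartPoint

end Summit.ResolutionOfSingularities.ResolutionOfSingularities.Theorems

end
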